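import Summits.AtomisticToContinuum.FouriersLaw.Theses.DiluteCellGaussianiser
import Summits.AtomisticToContinuum.FouriersLaw.Theorems.MatthiessenLadderPrefixSteadyStatesStubCellChainSmoothDensity
import Summits.AtomisticToContinuum.FouriersLaw.Theorems.MatthiessenLadderPrefixSteadyStatesStubCellChainInvariantUnique
import Summits.AtomisticToContinuum.FouriersLaw.Theorems.MatthiessenLadderPrefixSteadyStatesStubCellChainInvariantOfSteadyState
import Literature.MathematicalPhysics.KineticTheory.SiteDependentOscillatorChain
import HarnessLib

/-!
# Weak-NESS uniqueness for the dilute conjunct chains (stub `stub_diluteNessUnique` of crux `DiluteFourierLaw`)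

`--supports stmt-AtomisticToContinuum-12893` (crux `DiluteCellGaussianiser.DiluteFourierLaw`, line `birth`,
stub S1). For `ω₂, lam, β, γ > 0`, every spacing `d`, every size `N` and `T_L, T_R > 0`, any two weak steady
states (`SiteChain.IsSteadyState`) of the `d`-dilute conjunct chain `diluteChain ω₂ lam β γ d` coincide.
The dilute chain IS the cell chain with indicator `decide (d ∣ i)` (`diluteChain_eq_cellChain`), and for
EVERY cell chain the three kernel-level theorems landed for crux `PrefixSteadyStates`
(stmt-AtomisticToContinuum-12778, line `registered`) give uniqueness in the weak class for `N ≥ 1`: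
weak steady states have smooth densities (`stub_cellChainSmoothDensity`: Hörmander, CEHRB Prop. 4.1),
are therefore invariant for the Langevin kernels (`stub_cellChainInvariantOfSteadyState`: Fokker–Planck
identification), and the kernels have at most one invariant probability measure
(`stub_cellChainInvariantUnique`: Kalman + local small set + LaSalle). `N = 0`: phase space is a point.
-/

noncomputable section

namespace Summit.AtomisticToContinuum.FouriersLaw.Theorems.DiluteFourierLaw.LineBirth

open MeasureTheory Filter Topology Set
open scoped NNReal ENNReal ContDiff
open Literature.MathematicalPhysics.KineticTheory.HeatConduction
open Summit.AtomisticToContinuum.FouriersLaw.Theorems.PrefixSteadyStates.LineRegistered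
  (stub_cellChainSmoothDensity stub_cellChainInvariantOfSteadyState stub_cellChainInvariantUnique)

/-- **Weak-NESS uniqueness for every cell chain** (`ω₂ > 0`, `lam, β ≥ 0`, `γ > 0`, any cell indicator,
every `N`, `T_L, T_R > 0`). [cite: CuneoEckmannHairerReyBellet2018, Thm 2.13] -/
theorem cellChain_nessUnique {ω₂ lam β γ : ℝ} (hω : 0 < ω₂) (hl : 0 ≤ lam) (hβ : 0 ≤ β) (hγ : 0 < γ)
    (c : ℕ → Bool) (N : ℕ) {T_L T_R : ℝ} (hL : 0 < T_L) (hR : 0 < T_R) (μ ν : Measure (PhaseSpace N))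
    (hμ : (cellChain ω₂ lam β γ c).IsSteadyState N T_L T_R μ)
    (hν : (cellChain ω₂ lam β γ c).IsSteadyState N T_L T_R ν) : μ = ν := by
  haveI := hμ.1
  haveI := hν.1
  rcases Nat.eq_zero_or_pos N with rfl | hN
  · refine Measure.ext fun A _ => ?_
    rcases A.eq_empty_or_nonempty with rfl | hne
    · simp
    · have hA : A = Set.univ := Set.eq_univ_of_forall fun x => by
        obtain ⟨y, hy⟩ := hne
        rwa [Subsingleton.elim x y]
      rw [hA, measure_univ, measure_univ]
  · exact stub_cellChainInvariantUnique ω₂ lam β γ hω hl hβ hγ c N hN T_L T_R hL hR.le μ ν hμ.1 hν.1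
      (stub_cellChainInvariantOfSteadyState ω₂ lam β γ hω hl hβ hγ c N hN T_L T_R hL hR μ hμ
        (stub_cellChainSmoothDensity ω₂ lam β γ hω hl hβ hγ c N hN T_L T_R hL hR μ hμ))
      (stub_cellChainInvariantOfSteadyState ω₂ lam β γ hω hl hβ hγ c N hN T_L T_R hL hR ν hν
        (stub_cellChainSmoothDensity ω₂ lam β γ hω hl hβ hγ c N hN T_L T_R hL hR ν hν))

/-- **Registered stub S1 `stub_diluteNessUnique` of crux `DiluteFourierLaw` (stmt-AtomisticToContinuum-12893):**
weak steady states of the `d`-dilute conjunct chain are unique (by `cellChain_nessUnique` through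
`diluteChain_eq_cellChain`). [cite: CuneoEckmannHairerReyBellet2018, Thm 2.13] -/
theorem stub_diluteNessUnique :
    ∀ ω₂ lam β γ : ℝ, 0 < ω₂ → 0 < lam → 0 < β → 0 < γ → ∀ (d N : ℕ) (T_L T_R : ℝ),
    0 < T_L → 0 < T_R → ∀ μ ν : Measure (PhaseSpace N),
      (diluteChain ω₂ lam β γ d).IsSteadyState N T_L T_R μ →
      (diluteChain ω₂ lam β γ d).IsSteadyState N T_L T_R ν → μ = ν := by
  intro ω₂ lam β γ hω hl hβ hγ d N T_L T_R hL hR μ ν hμ hν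
  rw [diluteChain_eq_cellChain] at hμ hν
  exact cellChain_nessUnique hω hl.le hβ.le hγ _ N hL hR μ ν hμ hν

end Summit.AtomisticToContinuum.FouriersLaw.Theorems.DiluteFourierLaw.LineBirth

end
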